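import Literature.MathematicalPhysics.QuantumFieldTheory.Balaban1983to89.B7Prop1Local

/-!
# NODE 00 — THE TORUS→`ℤᵈ` TWIN, FILE 3a: INTEGRATING A BOND PHASE ALONG THE COORDINATE STAIRCASE OF A BOX OF `ℤᵈ` — the product identity
# `λ(x) = λ(lo)·e^{i·Σ_staircase φ}` for a site function `λ` with `λ(y + e_μ) = λ(y)·e^{iφ(y,μ)}` on the box's bonds, and EXACTNESS of the staircase sum on
# EVERY bond of the box when the angles are small (`(2W + 1)·τ < 2π`): the elementary input of the `U(N) → SU(N)` normalisation of [6]'s unitary gauges (FILE 3b)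

Cell `pub-ymgap`, seat `pub-ymgap-dag-n07-e` generation 10 (R141 (C) s3 «torus-vs-box twin», DAG node N07 = [15]; INTENT-25 programme FILE 27a, bus 2026-08-27).
NEW leaf on n05-a's `B7Prop1Local` only (`InBox`; `B7Prop1Explicit.(Site, e)`); nothing modified.  `--kind definition --supports stmt-QuantumFields-20506` (K0⁶).
[6] = [Balaban1985RegularSpaces]; [3] = [Balaban1985Averaging].

WHY.  [6] Prop. 6 ∕ Thm 2 hand over «a gauge transformation u» with values in the unitary group of `M_N(ℂ)` ([3] p. 18 «values in a Lie subgroup G of a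
unitary group U(N)»; tree: `∀ x, u x ∈ unitaryUnits 𝔸` in `Node00.GaugedBoundB8`), the record's gauges are `SU(N)`-valued.  On a box the determinant phase
`λ = det ∘ u` of such a gauge moves along each bond by a small real angle (Liouville, FILE 3b); THIS FILE is the lattice bookkeeping that integrates those
angles: the staircase sum `Θ` from the corner is a real potential with `λ = λ(lo)·e^{iΘ}` (a product identity along ONE path, §1) and — because
`e^{i(Θ(x+e_ν) − Θ(x) − φ(x,ν))} = 1` with modulus of the exponent `< 2π` — `Θ(x + e_ν) − Θ(x) = φ(x, ν)` on every bond of the box (§2), with no plaquette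
relation and no topology beyond the box's coordinates.  FILE 3b divides `u` by the `N`-th root `e^{iΘ∕N}`.

WHAT IS PROVED (kernel; `d` arbitrary; elementary; corner ∕ successor ∕ segment lemmas are private helpers).  §1 `stairPt`, `cornerPt`, `segSum`, `stairSum`,
`boxWidth` (5 defs) · ★ `lam_eq_mul_exp_stairSum` (`λ(x) = λ(lo)·e^{i·stairSum φ x}`) · `abs_stairSum_le` (`|stairSum φ x| ≤ W·τ`).  §2 ★★ `stairSum_add_e_sub_eq` (exactness on every bond: `stairSum φ (x + e_ν) − stairSum φ x = φ(x, ν)` when `λ(lo) ≠ 0`, `|φ| ≤ τ`, `(2W+1)·τ < 2π`).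
HONEST FRAMING: elementary lattice∕complex bookkeeping; nothing of Bałaban asserted or discharged; N07 ∕ N05 ∕ K0⁶ NOT discharged; counts unmoved (5∕27); one finite
T⁴ programme at fixed ε — NOT continuum ∕ ℝ⁴ ∕ infinite volume ∕ OS ∕ mass gap ∕ Clay.  No `sorry`, no `instance`, no `notation`.
-/

noncomputable section

namespace Literature.MathematicalPhysics.QuantumFieldTheory.Balaban1983to89.Node00

open Complex (I)
open B7Prop1Explicit (e e_apply)
open B7Prop1Local (InBox)

/-! ## §1  Integrating a bond phase along the coordinate staircase of a box -/

section Staircase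

variable {d : ℕ}

/-- The point of parameter `t` on the `m`-th segment of the coordinate staircase from `lo` to `x`: coordinates `< m` already those of `x`, coordinate `m`
equal to `t`, coordinates `> m` still those of `lo`. [folklore] -/
def stairPt (lo x : B7Prop1Explicit.Site d) (m : ℕ) (t : ℤ) : B7Prop1Explicit.Site d :=
  fun κ => if κ.val < m then x κ else if κ.val = m then t else lo κ

/-- The corner reached after the first `m` segments of the staircase: coordinates `< m` those of `x`, the others those of `lo`. [folklore] -/
def cornerPt (lo x : B7Prop1Explicit.Site d) (m : ℕ) : B7Prop1Explicit.Site d :=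
  fun κ => if κ.val < m then x κ else lo κ

/-- The sum of a bond function along the `μ`-th segment of the staircase (bonds `⟨p(t), p(t) + e_μ⟩`, `lo_μ ≤ t < x_μ`). [folklore] -/
def segSum (lo : B7Prop1Explicit.Site d) (φ : B7Prop1Explicit.Site d → Fin d → ℝ) (x : B7Prop1Explicit.Site d) (μ : Fin d) : ℝ :=
  ∑ i ∈ Finset.range (x μ - lo μ).toNat, φ (stairPt lo x μ.val (lo μ + i)) μ

/-- The sum of a bond function along the whole coordinate staircase from `lo` to `x`. [folklore] -/
def stairSum (lo : B7Prop1Explicit.Site d) (φ : B7Prop1Explicit.Site d → Fin d → ℝ) (x : B7Prop1Explicit.Site d) : ℝ :=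
  ∑ μ : Fin d, segSum lo φ x μ

/-- No segment walked: the staircase starts at `lo`. [folklore] -/
private theorem cornerPt_zero (lo x : B7Prop1Explicit.Site d) : cornerPt lo x 0 = lo := by
  funext κ; simp [cornerPt]

/-- All segments walked: the staircase ends at `x`. [folklore] -/
private theorem cornerPt_of_le (lo x : B7Prop1Explicit.Site d) {m : ℕ} (hm : d ≤ m) : cornerPt lo x m = x := by
  funext κ; simp [cornerPt, lt_of_lt_of_le κ.isLt hm]

/-- The `μ`-th segment starts at the `μ`-th corner. [folklore] -/
private theorem stairPt_lo (lo x : B7Prop1Explicit.Site d) (μ : Fin d) : stairPt lo x μ.val (lo μ) = cornerPt lo x μ.val := by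
  funext κ
  by_cases h1 : κ.val < μ.val
  · simp [stairPt, cornerPt, h1]
  · by_cases h2 : κ.val = μ.val
    · have : κ = μ := Fin.ext h2
      subst this
      simp [stairPt, cornerPt]
    · simp [stairPt, cornerPt, h1, h2]

/-- The `μ`-th segment ends at the `(μ+1)`-th corner. [folklore] -/
private theorem stairPt_self (lo x : B7Prop1Explicit.Site d) (μ : Fin d) : stairPt lo x μ.val (x μ) = cornerPt lo x (μ.val + 1) := by
  funext κ
  by_cases h1 : κ.val < μ.val
  · simp [stairPt, cornerPt, h1, Nat.lt_succ_of_lt h1]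
  · by_cases h2 : κ.val = μ.val
    · have : κ = μ := Fin.ext h2
      subst this
      simp [stairPt, cornerPt]
    · have h3 : ¬κ.val < μ.val + 1 := by omega
      simp [stairPt, cornerPt, h1, h2, h3]

/-- One step along the `μ`-th segment is the unit step `e_μ`. [folklore] -/
private theorem stairPt_succ (lo x : B7Prop1Explicit.Site d) (μ : Fin d) (t : ℤ) : stairPt lo x μ.val (t + 1) = stairPt lo x μ.val t + e μ := by
  funext κ
  rw [Pi.add_apply, e_apply]
  by_cases h1 : κ.val < μ.val
  · have : κ ≠ μ := fun h => by subst h; exact lt_irrefl _ h1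
    simp [stairPt, h1, this]
  · by_cases h2 : κ.val = μ.val
    · have : κ = μ := Fin.ext h2
      subst this
      simp [stairPt]
    · have : κ ≠ μ := fun h => h2 (by rw [h])
      simp [stairPt, h1, h2, this]

/-- The points of the `μ`-th segment with parameter in `[lo_μ, hi_μ]` lie in the box (when `x` does). [folklore] -/
private theorem inBox_stairPt {lo hi x : B7Prop1Explicit.Site d} (hx : InBox lo hi x) (μ : Fin d) {t : ℤ} (ht : lo μ ≤ t) (ht' : t ≤ hi μ) :
    InBox lo hi (stairPt lo x μ.val t) := by
  intro κ
  by_cases h1 : κ.val < μ.val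
  · simp only [stairPt, h1, ↓reduceIte]; exact hx κ
  · by_cases h2 : κ.val = μ.val
    · have : κ = μ := Fin.ext h2
      subst this
      simp only [stairPt, lt_irrefl, ↓reduceIte]; exact ⟨ht, ht'⟩
    · simp only [stairPt, h1, h2, ↓reduceIte]; exact ⟨le_rfl, (hx κ).1.trans (hx κ).2⟩

variable {lo hi x : B7Prop1Explicit.Site d} {lam : B7Prop1Explicit.Site d → ℂ} {φ : B7Prop1Explicit.Site d → Fin d → ℝ}

/-- The product identity along one segment: `λ(p(lo_μ + n)) = λ(corner_μ)·exp(i·Σ_{i<n} φ(p(lo_μ + i), μ))` for `n ≤ x_μ − lo_μ`. [folklore] -/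
private theorem lam_stairPt_eq (hx : InBox lo hi x)
    (hstep : ∀ y μ, InBox lo hi y → InBox lo hi (y + e μ) → lam (y + e μ) = lam y * Complex.exp (I * φ y μ)) (μ : Fin d) :
    ∀ n : ℕ, (n : ℤ) ≤ x μ - lo μ →
      lam (stairPt lo x μ.val (lo μ + n)) =
        lam (cornerPt lo x μ.val) * Complex.exp (I * ↑(∑ i ∈ Finset.range n, φ (stairPt lo x μ.val (lo μ + i)) μ))
  | 0, _ => by simp [stairPt_lo]
  | n + 1, hn => by
    have hn' : (n : ℤ) ≤ x μ - lo μ := by push_cast at hn; omega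
    have ih := lam_stairPt_eq hx hstep μ n hn'
    have hxμ := hx μ
    have hy : InBox lo hi (stairPt lo x μ.val (lo μ + n)) := inBox_stairPt hx μ (by omega) (by push_cast at hn; omega)
    have hy' : InBox lo hi (stairPt lo x μ.val (lo μ + n) + e μ) := by
      rw [← stairPt_succ]; exact inBox_stairPt hx μ (by omega) (by push_cast at hn; omega)
    have hs : stairPt lo x μ.val (lo μ + ((n + 1 : ℕ) : ℤ)) = stairPt lo x μ.val (lo μ + n) + e μ := by
      rw [← stairPt_succ]; push_cast; ring_nf
    rw [hs, hstep _ μ hy hy', ih, Finset.sum_range_succ, mul_assoc, ← Complex.exp_add]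
    push_cast
    ring_nf

/-- The product identity along the whole `μ`-th segment: `λ(corner_{μ+1}) = λ(corner_μ)·exp(i·segSum φ x μ)`. [folklore] -/
private theorem lam_cornerPt_succ_eq (hx : InBox lo hi x)
    (hstep : ∀ y μ, InBox lo hi y → InBox lo hi (y + e μ) → lam (y + e μ) = lam y * Complex.exp (I * φ y μ)) (μ : Fin d) :
    lam (cornerPt lo x (μ.val + 1)) = lam (cornerPt lo x μ.val) * Complex.exp (I * segSum lo φ x μ) := by
  have h0 : (0 : ℤ) ≤ x μ - lo μ := by have := hx μ; omega
  have h := lam_stairPt_eq hx hstep μ (x μ - lo μ).toNat (by rw [Int.toNat_of_nonneg h0])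
  rw [Int.toNat_of_nonneg h0, add_sub_cancel, stairPt_self] at h
  exact h

/-- The staircase sum as a `Finset.range` sum over the segment index (for inductions on the number of segments walked). [folklore] -/
private theorem stairSum_eq_sum_range (lo : B7Prop1Explicit.Site d) (φ : B7Prop1Explicit.Site d → Fin d → ℝ) (x : B7Prop1Explicit.Site d) :
    stairSum lo φ x = ∑ m ∈ Finset.range d, (if h : m < d then segSum lo φ x ⟨m, h⟩ else 0) := by
  rw [stairSum, ← Fin.sum_univ_eq_sum_range]
  refine Finset.sum_congr rfl fun μ _ => ?_
  rw [dif_pos μ.isLt]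

/-- ★ **THE PRODUCT IDENTITY ALONG THE STAIRCASE**: if `λ(y + e_μ) = λ(y)·e^{iφ(y,μ)}` on every bond of the box, then `λ(x) = λ(lo)·e^{i·stairSum φ x}` for
every `x` in the box (the determinant phase of [6]'s gauge `u` read along a contour, [3] (9)). [cite: Balaban1985Averaging, (9) p.18 (parallel transport along a contour; bookkeeping); Balaban1985RegularSpaces, Prop. 6 p.99] -/
theorem lam_eq_mul_exp_stairSum (hx : InBox lo hi x)
    (hstep : ∀ y μ, InBox lo hi y → InBox lo hi (y + e μ) → lam (y + e μ) = lam y * Complex.exp (I * φ y μ)) :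
    lam x = lam lo * Complex.exp (I * stairSum lo φ x) := by
  have key : ∀ m, m ≤ d → lam (cornerPt lo x m) =
      lam lo * Complex.exp (I * ↑(∑ i ∈ Finset.range m, (if h : i < d then segSum lo φ x ⟨i, h⟩ else 0))) := by
    intro m
    induction m with
    | zero => intro _; simp [cornerPt_zero]
    | succ m ih =>
      intro hm
      have hm' : m < d := hm
      rw [lam_cornerPt_succ_eq hx hstep ⟨m, hm'⟩, ih hm'.le, Finset.sum_range_succ, dif_pos hm', mul_assoc, ← Complex.exp_add]
      push_cast
      ring_nf
  have h := key d le_rfl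
  rwa [cornerPt_of_le lo x le_rfl, ← stairSum_eq_sum_range] at h

/-- The total width of the box, `W = Σ_μ (hi_μ − lo_μ)` (the number of bonds of the longest staircase). [folklore] -/
def boxWidth (lo hi : B7Prop1Explicit.Site d) : ℝ := ∑ μ : Fin d, ((hi μ - lo μ : ℤ) : ℝ)

/-- One segment sum is at most `(hi_μ − lo_μ)·τ` in absolute value when `|φ| ≤ τ` (`τ ≥ 0`) on the box's bonds. [folklore] -/
private theorem abs_segSum_le (hx : InBox lo hi x) {τ : ℝ} (hτ0 : 0 ≤ τ) (hτ : ∀ y μ, InBox lo hi y → InBox lo hi (y + e μ) → |φ y μ| ≤ τ) (μ : Fin d) :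
    |segSum lo φ x μ| ≤ ((hi μ - lo μ : ℤ) : ℝ) * τ := by
  have h0 : (0 : ℤ) ≤ x μ - lo μ := by have := hx μ; omega
  unfold segSum
  calc |∑ i ∈ Finset.range (x μ - lo μ).toNat, φ (stairPt lo x μ.val (lo μ + i)) μ|
      ≤ ∑ i ∈ Finset.range (x μ - lo μ).toNat, |φ (stairPt lo x μ.val (lo μ + i)) μ| := Finset.abs_sum_le_sum_abs _ _
    _ ≤ ∑ _i ∈ Finset.range (x μ - lo μ).toNat, τ := by
        refine Finset.sum_le_sum fun i hi => hτ _ μ ?_ ?_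
        · exact inBox_stairPt hx μ (by omega) (by have := Finset.mem_range.1 hi; have := (hx μ).2; omega)
        · rw [← stairPt_succ]
          exact inBox_stairPt hx μ (by omega) (by have := Finset.mem_range.1 hi; have := (hx μ).2; omega)
    _ = ((x μ - lo μ).toNat : ℝ) * τ := by rw [Finset.sum_const, Finset.card_range, nsmul_eq_mul]
    _ ≤ ((hi μ - lo μ : ℤ) : ℝ) * τ := by
        refine mul_le_mul_of_nonneg_right ?_ hτ0
        have h1 : ((x μ - lo μ).toNat : ℤ) ≤ hi μ - lo μ := by rw [Int.toNat_of_nonneg h0]; have := (hx μ).2; omega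
        exact_mod_cast h1

/-- The staircase sum is at most `W·τ` in absolute value, `W` the total width of the box. [cite: Balaban1985Averaging, (9) p.18 (bookkeeping)] -/
theorem abs_stairSum_le (hx : InBox lo hi x) {τ : ℝ} (hτ0 : 0 ≤ τ) (hτ : ∀ y μ, InBox lo hi y → InBox lo hi (y + e μ) → |φ y μ| ≤ τ) :
    |stairSum lo φ x| ≤ boxWidth lo hi * τ := by
  unfold stairSum boxWidth
  rw [Finset.sum_mul]
  exact (Finset.abs_sum_le_sum_abs _ _).trans (Finset.sum_le_sum fun μ _ => abs_segSum_le hx hτ0 hτ μ)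

/-! ## §2  Exactness of the staircase sum on every bond of the box -/

/-- A real number `δ` with `e^{iδ} = 1` and `|δ| < 2π` vanishes. [folklore] -/
private theorem eq_zero_of_exp_I_mul_eq_one {δ : ℝ} (h : Complex.exp (I * δ) = 1) (hδ : |δ| < 2 * Real.pi) : δ = 0 := by
  obtain ⟨n, hn⟩ := Complex.exp_eq_one_iff.1 h
  have hnorm : |δ| = |(n : ℝ)| * (2 * Real.pi) := by
    have h1 : ‖(I * δ : ℂ)‖ = ‖(n : ℂ) * (2 * Real.pi * I)‖ := by rw [hn]
    rw [norm_mul, Complex.norm_I, one_mul, Complex.norm_real, Real.norm_eq_abs] at h1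
    rw [h1, norm_mul, Complex.norm_intCast]
    have : ‖(2 * Real.pi * I : ℂ)‖ = 2 * Real.pi := by
      rw [norm_mul, Complex.norm_I, mul_one]
      simp [abs_of_pos Real.pi_pos]
    rw [this]
  have hn0 : n = 0 := by
    have h2 : |(n : ℝ)| * (2 * Real.pi) < 1 * (2 * Real.pi) := by rw [← hnorm, one_mul]; exact hδ
    have h3 : |(n : ℝ)| < 1 := lt_of_mul_lt_mul_right h2 (by positivity)
    have : |n| < 1 := by exact_mod_cast h3
    exact Int.abs_lt_one_iff.1 this
  subst hn0
  have h4 : (I * δ : ℂ) = 0 := by rw [hn]; simp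
  have h5 : (δ : ℂ) = 0 := by
    rcases mul_eq_zero.1 h4 with h6 | h6
    · exact absurd h6 Complex.I_ne_zero
    · exact h6
  exact_mod_cast h5

/-- ★★ **EXACTNESS ON EVERY BOND OF THE BOX**: if `λ(y + e_μ) = λ(y)·e^{iφ(y,μ)}` on the box's bonds, `λ(lo) ≠ 0`, `|φ| ≤ τ` there and `(2W + 1)·τ < 2π`,
then the staircase sum is a potential for `φ` on the whole box: `stairSum φ (x + e_ν) − stairSum φ x = φ(x, ν)` for every bond `⟨x, x + e_ν⟩` of the box
(the two staircases and the bond close a loop whose phase is an integer multiple of `2π` of size `< 2π`). [cite: Balaban1985Averaging, (9) p.18 (parallel transport along contours; bookkeeping); Balaban1985RegularSpaces, Prop. 6 p.99 («there exists a gauge transformation u»)] -/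
theorem stairSum_add_e_sub_eq (hx : InBox lo hi x) {ν : Fin d} (hx' : InBox lo hi (x + e ν))
    (hstep : ∀ y μ, InBox lo hi y → InBox lo hi (y + e μ) → lam (y + e μ) = lam y * Complex.exp (I * φ y μ))
    (hlam : lam lo ≠ 0) {τ : ℝ} (hτ0 : 0 ≤ τ) (hτ : ∀ y μ, InBox lo hi y → InBox lo hi (y + e μ) → |φ y μ| ≤ τ)
    (hsmall : (2 * boxWidth lo hi + 1) * τ < 2 * Real.pi) :
    stairSum lo φ (x + e ν) - stairSum lo φ x = φ x ν := by
  have h1 := lam_eq_mul_exp_stairSum hx hstep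
  have h2 := lam_eq_mul_exp_stairSum hx' hstep
  have h3 := hstep x ν hx hx'
  -- `e^{i S'} = e^{i S} · e^{i φ}`
  have h4 : Complex.exp (I * stairSum lo φ (x + e ν)) = Complex.exp (I * stairSum lo φ x) * Complex.exp (I * φ x ν) := by
    have h5 : lam lo * Complex.exp (I * stairSum lo φ (x + e ν)) = lam lo * (Complex.exp (I * stairSum lo φ x) * Complex.exp (I * φ x ν)) := by
      rw [← h2, h3, h1, mul_assoc]
    exact mul_left_cancel₀ hlam h5
  have h6 : Complex.exp (I * ↑(stairSum lo φ (x + e ν) - stairSum lo φ x - φ x ν)) = 1 := by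
    have h7 : Complex.exp (I * stairSum lo φ x) * Complex.exp (I * φ x ν) ≠ 0 :=
      mul_ne_zero (Complex.exp_ne_zero _) (Complex.exp_ne_zero _)
    have h8 : Complex.exp (I * ↑(stairSum lo φ (x + e ν) - stairSum lo φ x - φ x ν)) *
        (Complex.exp (I * stairSum lo φ x) * Complex.exp (I * φ x ν)) = Complex.exp (I * stairSum lo φ (x + e ν)) := by
      rw [← Complex.exp_add, ← Complex.exp_add]
      push_cast
      ring_nf
    rw [h4] at h8
    exact (mul_eq_right₀ h7).1 h8
  refine sub_eq_zero.1 (eq_zero_of_exp_I_mul_eq_one h6 ?_)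
  have hS := abs_stairSum_le hx hτ0 hτ
  have hS' := abs_stairSum_le hx' hτ0 hτ
  have hφ := hτ x ν hx hx'
  calc |stairSum lo φ (x + e ν) - stairSum lo φ x - φ x ν| ≤ |stairSum lo φ (x + e ν)| + |stairSum lo φ x| + |φ x ν| := by
        have ha := abs_sub (stairSum lo φ (x + e ν) - stairSum lo φ x) (φ x ν)
        have hb := abs_sub (stairSum lo φ (x + e ν)) (stairSum lo φ x)
        linarith
    _ ≤ boxWidth lo hi * τ + boxWidth lo hi * τ + τ := by gcongr
    _ = (2 * boxWidth lo hi + 1) * τ := by ring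
    _ < 2 * Real.pi := hsmall

end Staircase


end Literature.MathematicalPhysics.QuantumFieldTheory.Balaban1983to89.Node00

end
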